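import Mathlib
import HarnessLib
import Summits.HubbardSuperconductivity.HubbardSuperconductivity.Theses.KLProgramme
import Summits.HubbardSuperconductivity.HubbardSuperconductivity.Theorems.KLProgrammeCountPairsOffsetCooper
import Summits.HubbardSuperconductivity.HubbardSuperconductivity.Theorems.KLProgrammeCountPairsOffsetFold

/-!
# Route `KLProgramme` — support item `CountPairsOffset` (stmt-HubbardSuperconductivity-20036), PROVED:
# the two-dimensional count for an arbitrary offset and the route item

`count_pairs_offset_exists`: for constants chosen small in terms of the uniform bounds `B` there is `K'_p` with
`#{(a, c) : |h_P(θ_a, θ_c)| ≤ C_δ w} ≤ K'_p (J + 2 + log N)/w`, uniformly in the level and IN THE OFFSET `P` (the tree's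
`count_pairs_exists` assembly with the Cooper range replaced by `count_odd_total_offset`). `CountPairsOffset_proof`: the
route item `Summit.….Theses.KLProgramme.CountPairsOffset` (S5 of DECOMP = App. F Lemma F.1, the `2n`-leg sector count
modulo `2πℤ²` = BGM 2006 (2.76)/(2.80) for all `|P_v|` at intermediate filling), from `bandBounds` on `[a, b]`,
`exists_small_constants_offset`, the count for fine grids and the trivial bound `N²` for coarse ones. Consequence recorded in
the cell: the C5a kill test of DECOMP §4 (a `γ`-power loss in the 6/8-leg count) does not bite — the bound has BGM's shape
`γ^{-h}|h|` for every offset.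
References: G. Benfatto, A. Giuliani, V. Mastropietro, Ann. Henri Poincaré 7 (2006) 809–898, Lemma 3.1, (2.76), (2.80),
App. A2; Ann. Henri Poincaré 4 (2003) 137–193, §7. Mathematics: HOME/prover-p4/COUNTING-NOTE.md (cell gate-hubbard-kl).
-/

noncomputable section

namespace Summit.HubbardSuperconductivity.HubbardSuperconductivity.Theorems.CountPairsOffset

set_option linter.dupNamespace false -- summit = problem name (single-conjunct summit), D-0017

open Real Set
open Literature.MathematicalPhysics.QuantumLattice Literature.MathematicalPhysics.QuantumLattice.BandSectorCounting

section Assembly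

variable {a b : ℝ} (B : BandBounds a b) {μ : ℝ} (hμ : μ ∈ Icc a b)
include B hμ

omit hμ in
set_option maxHeartbeats 1600000 in
/-- **The two-dimensional count for an ARBITRARY offset** (DECOMP App. F Lemma F.1): for constants chosen small in terms
of the uniform bounds `B`, there is `K'_p` with `#{(a, c) : |h_P(θ_a, θ_c)| ≤ C_δ w} ≤ K'_p (J + 2 + log N)/w` on every
grid `N w = 2π`, `2^J w = π`, uniformly in the level `μ` (with margin `η₀`) AND IN THE OFFSET `P ∈ ℝ²`. The tree's
`count_pairs_exists` is the case `P = p(θ₁)`; the proof is the tree's fibration scheme with the Cooper range replaced by the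
gated count `count_odd_total_offset` (no `η_o`). -/
theorem count_pairs_offset_exists {Cδ τ lam η₀ η₁ : ℝ} (hCδ : 0 < Cδ) (hτ : 0 < τ) (hτπ : τ < π) (hlam : 0 < lam)
    (hη₀ : 0 < η₀) (hη₁ : 0 < η₁)
    (hcov : 2 * (B.Cg * (lam / 2 + 2 * B.smax * (η₀ / B.Dtmin))) ≤ τ)
    (hodd : 4 * B.A2 * (η₀ / B.Dtmin + B.smax * (B.Cg * (lam + 2 * B.smax * (η₀ / B.Dtmin)) + τ)) ≤ B.hmin)
    (heven : 2 * B.A2 * (η₀ / B.Dtmin + B.smax * (B.Cg * (lam + B.A2 * τ + 2 * B.smax * (η₀ / B.Dtmin)) + τ / 2)) ≤ B.hmin / 2)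
    (hH : (16 * B.smax ^ 2 + 8 * B.A2) * (η₀ / B.Dtmin + B.smax * (B.Cg * (η₁ / 4 + 2 * B.smax * (η₀ / B.Dtmin)))) ≤ 2 * B.hmin) :
    ∃ Kp : ℝ, 0 < Kp ∧ ∀ μ : ℝ, μ ∈ Icc a b → a ≤ μ - η₀ → μ + η₀ ≤ b →
      ∀ (P : ℝ × ℝ) (w : ℝ) (N Nh J : ℕ), 0 < w → w ≤ 1 → (N : ℝ) * w = 2 * π → (Nh : ℝ) * w = π → N = 2 * Nh →
        (2 : ℝ) ^ J * w = π → Cδ * w ≤ η₀ / 2 →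
        ((((Finset.range N ×ˢ Finset.range N).filter fun p : ℕ × ℕ =>
            |hfunP μ P (w / 2 + p.1 * w) (w / 2 + p.2 * w)| ≤ Cδ * w).card : ℝ)) ≤
          Kp * ((J : ℝ) + 2 + Real.log N) / w := by
  have hA := B.A2_pos; have hs := B.smax_pos; have hh := B.hmin_pos; have hCg := B.Cg_pos; have hDt := B.Dtmin_pos
  have hπ := Real.pi_pos
  -- the big constants
  obtain ⟨Kdy, hKdy⟩ : ∃ Kdy : ℝ, Kdy = 2 * Real.sqrt (Cδ / (B.hmin / 2)) *
          (2 * (32 * (4 * π / min (η₀ / (2 * (8 * B.smax))) (η₁ / (4 * (16 * B.smax ^ 2 + 8 * B.A2))) + 1) / η₁ + 16 * π / η₀) * Cδ +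
            (8 * (4 * π / min (η₀ / (2 * (8 * B.smax))) (η₁ / (4 * (16 * B.smax ^ 2 + 8 * B.A2))) + 1) / Real.sqrt (2 * B.hmin)) * Real.sqrt (2 * Cδ) +
            2 * (4 * π / min (η₀ / (2 * (8 * B.smax))) (η₁ / (4 * (16 * B.smax ^ 2 + 8 * B.A2))) + 1)) +
        (2 * (32 * (4 * π / min (η₀ / (2 * (8 * B.smax))) (η₁ / (4 * (16 * B.smax ^ 2 + 8 * B.A2))) + 1) / η₁ + 16 * π / η₀) *
            (2 * Cδ * Real.sqrt (2 * (2 * B.A2)) / (B.hmin / 2)) * Real.sqrt (Cδ * π) +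
          Real.sqrt 2 * (8 * (4 * π / min (η₀ / (2 * (8 * B.smax))) (η₁ / (4 * (16 * B.smax ^ 2 + 8 * B.A2))) + 1) / Real.sqrt (2 * B.hmin)) *
            (2 * Cδ * Real.sqrt (2 * (2 * B.A2)) / (B.hmin / 2)) +
          2 * (4 * π / min (η₀ / (2 * (8 * B.smax))) (η₁ / (4 * (16 * B.smax ^ 2 + 8 * B.A2))) + 1) *
            (2 * Cδ * Real.sqrt (2 * (2 * B.A2)) / (B.hmin / 2)) / Real.sqrt Cδ) +
        8 * π * (2 * Cδ * Real.sqrt (2 * (2 * B.A2)) / (B.hmin / 2)) / Real.sqrt (2 * Cδ * π) := ⟨_, rfl⟩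
  obtain ⟨F₅, hF₅⟩ : ∃ F₅ : ℝ, F₅ = τ / min (η₀ / (2 * (2 * B.A2) * τ)) (2 * lam / (8 * B.smax ^ 2 + 4 * B.A2)) + 1 := ⟨_, rfl⟩
  obtain ⟨C₅, hC₅⟩ : ∃ C₅ : ℝ, C₅ = 2 * π / min (η₀ / (2 * (4 * B.A2 * τ))) (lam / (8 * B.smax ^ 2 + 4 * B.A2)) + 1 := ⟨_, rfl⟩
  obtain ⟨C₃', hC₃'⟩ : ∃ C₃' : ℝ, C₃' = (2 * π / (lam / (2 * (4 * B.smax ^ 2 + 4 * B.A2))) + 1) * (2 * (4 * Cδ / lam + 1)) := ⟨_, rfl⟩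
  have hℓ₄ : 0 < min (η₀ / (2 * (8 * B.smax))) (η₁ / (4 * (16 * B.smax ^ 2 + 8 * B.A2))) := lt_min (by positivity) (by positivity)
  have hℓ₅ : 0 < min (η₀ / (2 * (2 * B.A2) * τ)) (2 * lam / (8 * B.smax ^ 2 + 4 * B.A2)) := lt_min (by positivity) (by positivity)
  have hKdy0 : 0 ≤ Kdy := by rw [hKdy]; positivity
  have hF₅0 : 0 ≤ F₅ := by rw [hF₅]; positivity
  have hℓO : 0 < min (η₀ / (2 * (4 * B.A2 * τ))) (lam / (8 * B.smax ^ 2 + 4 * B.A2)) := lt_min (by positivity) (by positivity)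
  have hC₅0 : 0 ≤ C₅ := by rw [hC₅]; positivity
  have hC₃'0 : 0 ≤ C₃' := by rw [hC₃']; positivity
  refine ⟨4 * π * C₃' + (2 * π + 2 * (F₅ * (2 * (Kdy + 8 * π)))) +
      (2 * π + 2 * C₅ * (2 * Cδ / B.hmin * 2 + 2 * π)), by positivity,
    fun μ hμ hlo hhi P w N Nh J hw hw1 hN hNh hNN hJ h2δ => ?_⟩
  obtain ⟨h1, h2⟩ := B.level hμ
  have hδη : Cδ * w ≤ η₀ := by linarith only [h2δ, hη₀]
  have hδ0 : 0 ≤ Cδ * w := by positivity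
  have hN0 : (0 : ℝ) < N := by
    have : (0:ℝ) < N * w := by rw [hN]; positivity
    exact pos_of_mul_pos_left this hw.le
  have hNpos : 0 < N := Nat.pos_of_ne_zero (fun h0 => by rw [h0] at hN0; simp at hN0)
  have hN1 : (1 : ℝ) ≤ N := by exact_mod_cast hNpos
  have hlog : 0 ≤ Real.log N := Real.log_nonneg hN1
  have hJ0 : (0 : ℝ) ≤ J := by positivity
  -- the three families of pairs
  set S := Finset.range N ×ˢ Finset.range N with hS
  set PP := S.filter (fun p : ℕ × ℕ => |hfunP μ P (w / 2 + p.1 * w) (w / 2 + p.2 * w)| ≤ Cδ * w) with hPP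
  set P₃ := S.filter (fun p : ℕ × ℕ => |hfunP μ P (w / 2 + p.1 * w) (w / 2 + p.2 * w)| ≤ Cδ * w ∧
    lam ≤ |h3P μ P (w / 2 + p.1 * w) (w / 2 + p.2 * w)|) with hP₃
  set P₂ := S.filter (fun p : ℕ × ℕ => |hfunP μ P (w / 2 + p.1 * w) (w / 2 + p.2 * w)| ≤ Cδ * w ∧
    lam ≤ |h3P μ P (w / 2 + p.2 * w) (w / 2 + p.1 * w)|) with hP₂
  set P₀ := S.filter (fun p : ℕ × ℕ => |hfunP μ P (w / 2 + p.1 * w) (w / 2 + p.2 * w)| ≤ Cδ * w ∧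
    |h3P μ P (w / 2 + p.1 * w) (w / 2 + p.2 * w)| < lam ∧ |h3P μ P (w / 2 + p.2 * w) (w / 2 + p.1 * w)| < lam) with hP₀
  have hsub : PP ⊆ P₃ ∪ (P₂ ∪ P₀) := by
    intro p hp
    rw [hPP, Finset.mem_filter] at hp
    rw [Finset.mem_union, Finset.mem_union, hP₃, hP₂, hP₀, Finset.mem_filter, Finset.mem_filter, Finset.mem_filter]
    by_cases h3a : lam ≤ |h3P μ P (w / 2 + p.1 * w) (w / 2 + p.2 * w)|
    · exact Or.inl ⟨hp.1, hp.2, h3a⟩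
    · by_cases h3b : lam ≤ |h3P μ P (w / 2 + p.2 * w) (w / 2 + p.1 * w)|
      · exact Or.inr (Or.inl ⟨hp.1, hp.2, h3b⟩)
      · exact Or.inr (Or.inr ⟨hp.1, hp.2, not_le.1 h3a, not_le.1 h3b⟩)
  have hcardP : (PP.card : ℝ) ≤ (P₃.card : ℝ) + (P₂.card : ℝ) + (P₀.card : ℝ) := by
    have e1 := Finset.card_le_card hsub
    have e2 := Finset.card_union_le P₃ (P₂ ∪ P₀)
    have e3 := Finset.card_union_le P₂ P₀
    have : PP.card ≤ P₃.card + P₂.card + P₀.card := by omega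
    exact_mod_cast this
  -- the transversal families
  have hC₃eq : (2 * π / (lam / (2 * (4 * B.smax ^ 2 + 4 * B.A2))) + 1) * (2 * ((4 * (Cδ * w) / lam) / w + 1)) = C₃' := by
    rw [hC₃']; congr 2; field_simp
  have hP₃ : (P₃.card : ℝ) ≤ N * C₃' := by
    calc (P₃.card : ℝ) = ∑ i ∈ Finset.range N, ((((Finset.range N).filter fun c : ℕ =>
          |hfunP μ P (w / 2 + i * w) (w / 2 + c * w)| ≤ Cδ * w ∧ lam ≤ |h3P μ P (w / 2 + i * w) (w / 2 + c * w)|).card : ℝ)) :=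
          card_filter_prod_eq_sum N (fun i c : ℕ => |hfunP μ P (w / 2 + i * w) (w / 2 + c * w)| ≤ Cδ * w ∧
            lam ≤ |h3P μ P (w / 2 + i * w) (w / 2 + c * w)|)
      _ ≤ N * ((2 * π / (lam / (2 * (4 * B.smax ^ 2 + 4 * B.A2))) + 1) * (2 * ((4 * (Cδ * w) / lam) / w + 1))) :=
          count_transversalP B hμ hw hlam hδ0 hN
      _ = N * C₃' := by rw [hC₃eq]
  have hP₂ : (P₂.card : ℝ) ≤ N * C₃' := by
    calc (P₂.card : ℝ) = ∑ c ∈ Finset.range N, ((((Finset.range N).filter fun i : ℕ =>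
          |hfunP μ P (w / 2 + i * w) (w / 2 + c * w)| ≤ Cδ * w ∧ lam ≤ |h3P μ P (w / 2 + c * w) (w / 2 + i * w)|).card : ℝ)) :=
          card_filter_prod_eq_sum' N (fun i c : ℕ => |hfunP μ P (w / 2 + i * w) (w / 2 + c * w)| ≤ Cδ * w ∧
            lam ≤ |h3P μ P (w / 2 + c * w) (w / 2 + i * w)|)
      _ ≤ N * ((2 * π / (lam / (2 * (4 * B.smax ^ 2 + 4 * B.A2))) + 1) * (2 * ((4 * (Cδ * w) / lam) / w + 1))) :=
          count_transversalP' B hμ hw hlam hδ0 hN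
      _ = N * C₃' := by rw [hC₃eq]
  -- the family with both partials small
  set f : ℕ → ℝ := fun k => ((((Finset.range N).filter fun i : ℕ =>
      |hfunP μ P (w / 2 + i * w) (w / 2 + i * w + k * w)| ≤ Cδ * w ∧
      |h3P μ P (w / 2 + i * w) (w / 2 + i * w + k * w)| < lam ∧
      |h3P μ P (w / 2 + i * w + k * w) (w / 2 + i * w)| < lam).card : ℝ)) with hf
  have hP₀ : (P₀.card : ℝ) ≤ ∑ k ∈ Finset.range N, f k := count_reindexP B hμ hN
  have hf0 : ∀ k, 0 ≤ f k := fun k => by positivity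
  have hsplit := sum_split_three (N := N) f (fun k : ℕ => (k : ℝ) * w ≤ τ) (fun k : ℕ => |(k : ℝ) * w - π| ≤ τ)
    (fun k : ℕ => 2 * π - τ ≤ (k : ℝ) * w) hf0 (by
      intro k hk hfk
      rw [Finset.mem_range] at hk
      have hne : ((Finset.range N).filter fun i : ℕ =>
          |hfunP μ P (w / 2 + i * w) (w / 2 + i * w + k * w)| ≤ Cδ * w ∧
          |h3P μ P (w / 2 + i * w) (w / 2 + i * w + k * w)| < lam ∧
          |h3P μ P (w / 2 + i * w + k * w) (w / 2 + i * w)| < lam).Nonempty := by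
        rw [← Finset.card_pos]
        by_contra h0
        push Not at h0
        have : f k = 0 := by rw [hf]; dsimp only; exact_mod_cast Nat.le_zero.1 h0
        exact hfk this
      obtain ⟨i, hi⟩ := hne
      rw [Finset.mem_filter] at hi
      exact krangeP B hμ hw hN hk hτπ hlo hhi hδη hcov hi.2)
  have hA' := count_even_posP (μ := μ) (P := P) (δ := Cδ * w) (lam := lam) (τ := τ) hw (N := N)
  have hBo : ∑ k ∈ (Finset.range N).filter (fun k : ℕ => |(k : ℝ) * w - π| ≤ τ), f k ≤
      N + 2 * C₅ * ((2 * (Cδ * w) / (B.hmin * w)) * (2 * (1 + Real.log N)) / w + N) := by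
    have := count_odd_total_offset B hμ (P := P) (δ := Cδ * w) (lam := lam) (τ := τ) hw hN hNh hNN (by positivity)
      hη₀ hlam hτ h2δ hlo hhi hodd
    rw [← hC₅] at this
    exact this
  have hC' := count_even_negP B hμ (P := P) (δ := Cδ * w) (lam := lam) (τ := τ) hw hN
  have hE : ∑ s ∈ Finset.range (4 * N), ((((Finset.range ⌊τ / w⌋₊).filter fun i : ℕ =>
      |hfunP μ P (w / 2 + s * (w / 2) - (w + i * w) / 2) (w / 2 + s * (w / 2) + (w + i * w) / 2)| ≤ Cδ * w ∧
      |GfunP μ P (w / 2 + s * (w / 2)) (w + i * w)| ≤ 2 * lam).card : ℝ)) ≤ F₅ * (2 * (((J : ℝ) + 1) * Kdy / w + 4 * N)) := by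
    have := count_anti_totalP B hμ (P := P) hw hw1 hN hJ hCδ hlam hτ hη₀ hη₁ h2δ hlo hhi heven hH
    rw [← hKdy, ← hF₅] at this
    exact this
  clear hKdy hF₅ hC₅ hC₃' hC₃eq
  -- abbreviate the logarithm and the sums, and use `N = 2π/w`
  set lg := Real.log (N : ℝ) with hlg
  set L := (J : ℝ) + 2 + lg with hL
  have hL1 : 1 ≤ L := by rw [hL]; linarith only [hlog, hJ0]
  have hNw : (N : ℝ) = 2 * π / w := by field_simp; linarith only [hN]
  set EE := ∑ s ∈ Finset.range (4 * N), ((((Finset.range ⌊τ / w⌋₊).filter fun i : ℕ =>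
      |hfunP μ P (w / 2 + s * (w / 2) - (w + i * w) / 2) (w / 2 + s * (w / 2) + (w + i * w) / 2)| ≤ Cδ * w ∧
      |GfunP μ P (w / 2 + s * (w / 2)) (w + i * w)| ≤ 2 * lam).card : ℝ)) with hEE
  set OD := ∑ k ∈ (Finset.range N).filter (fun k : ℕ => |(k : ℝ) * w - π| ≤ τ), f k with hOD
  have hEB : EE ≤ F₅ * (2 * (Kdy + 8 * π)) * L / w := by
    refine hE.trans ?_
    have h4N : (4 : ℝ) * N = 8 * π / w := by rw [hNw]; ring
    have key : ((J : ℝ) + 1) * Kdy + 8 * π ≤ (Kdy + 8 * π) * L := by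
      rw [hL]; nlinarith only [hlog, hKdy0, hπ, hJ0]
    calc F₅ * (2 * (((J : ℝ) + 1) * Kdy / w + 4 * N)) = F₅ * (2 * ((((J : ℝ) + 1) * Kdy + 8 * π) / w)) := by
          rw [h4N, add_div]
      _ = F₅ * 2 * (((J : ℝ) + 1) * Kdy + 8 * π) / w := by ring
      _ ≤ F₅ * 2 * ((Kdy + 8 * π) * L) / w := by gcongr
      _ = F₅ * (2 * (Kdy + 8 * π)) * L / w := by ring
  have hodd' : OD ≤ (2 * π + 2 * C₅ * (2 * Cδ / B.hmin * 2 + 2 * π)) * L / w := by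
    refine hBo.trans ?_
    have e2 : 2 * (Cδ * w) / (B.hmin * w) = 2 * Cδ / B.hmin := by field_simp
    rw [e2, hNw]
    have t1 : 1 + lg ≤ L := by rw [hL]; linarith only [hJ0]
    have t2 : 0 ≤ 2 * Cδ / B.hmin := by positivity
    have key : 2 * π + 2 * C₅ * (2 * Cδ / B.hmin * (2 * (1 + lg)) + 2 * π) ≤
        (2 * π + 2 * C₅ * (2 * Cδ / B.hmin * 2 + 2 * π)) * L := by
      have f1 : 2 * π ≤ 2 * π * L := le_mul_of_one_le_right (by positivity) hL1
      have f2 : 2 * Cδ / B.hmin * (2 * (1 + lg)) ≤ 2 * Cδ / B.hmin * (2 * L) :=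
        mul_le_mul_of_nonneg_left (by linarith only [t1]) t2
      have f4 : 2 * C₅ * (2 * Cδ / B.hmin * (2 * (1 + lg)) + 2 * π) ≤ 2 * C₅ * (2 * Cδ / B.hmin * (2 * L) + 2 * π * L) :=
        mul_le_mul_of_nonneg_left (add_le_add f2 f1) (by positivity)
      have e : (2 * π + 2 * C₅ * (2 * Cδ / B.hmin * 2 + 2 * π)) * L =
          2 * π * L + 2 * C₅ * (2 * Cδ / B.hmin * (2 * L) + 2 * π * L) := by ring
      rw [e]; linarith only [f1, f4]
    calc 2 * π / w + 2 * C₅ * (2 * Cδ / B.hmin * (2 * (1 + lg)) / w + 2 * π / w)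
        = (2 * π + 2 * C₅ * (2 * Cδ / B.hmin * (2 * (1 + lg)) + 2 * π)) / w := by
          field_simp
      _ ≤ (2 * π + 2 * C₅ * (2 * Cδ / B.hmin * 2 + 2 * π)) * L / w :=
          div_le_div_of_nonneg_right key hw.le
  have heven' : N + 2 * EE ≤ (2 * π + 2 * (F₅ * (2 * (Kdy + 8 * π)))) * L / w := by
    rw [hNw]
    have t : 2 * π / w ≤ 2 * π * L / w := by
      apply div_le_div_of_nonneg_right _ hw.le; nlinarith only [hL1, hπ]
    have e : (2 * π + 2 * (F₅ * (2 * (Kdy + 8 * π)))) * L / w = 2 * π * L / w + 2 * (F₅ * (2 * (Kdy + 8 * π)) * L / w) := by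
      ring
    rw [e]; linarith only [t, hEB]
  have htrans' : 2 * (N * C₃') ≤ 4 * π * C₃' * L / w := by
    rw [hNw]
    have e : 2 * (2 * π / w * C₃') = 4 * π * C₃' / w := by field_simp; ring
    rw [e]
    apply div_le_div_of_nonneg_right _ hw.le
    exact le_mul_of_one_le_right (by positivity) hL1
  -- combine
  have h0 : (P₀.card : ℝ) ≤ (2 * π + 2 * (F₅ * (2 * (Kdy + 8 * π)))) * L / w +
      (2 * π + 2 * C₅ * (2 * Cδ / B.hmin * 2 + 2 * π)) * L / w := by
    have := hP₀.trans hsplit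
    linarith only [this, hA', hC', heven', hodd', hEB]
  have e : (4 * π * C₃' + (2 * π + 2 * (F₅ * (2 * (Kdy + 8 * π)))) +
      (2 * π + 2 * C₅ * (2 * Cδ / B.hmin * 2 + 2 * π))) * L / w =
      4 * π * C₃' * L / w + ((2 * π + 2 * (F₅ * (2 * (Kdy + 8 * π)))) * L / w +
      (2 * π + 2 * C₅ * (2 * Cδ / B.hmin * 2 + 2 * π)) * L / w) := by ring
  rw [e]
  linarith only [hcardP, hP₃, hP₂, htrans', h0]

end Assembly

end Summit.HubbardSuperconductivity.HubbardSuperconductivity.Theorems.CountPairsOffset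

namespace Summit.HubbardSuperconductivity.HubbardSuperconductivity.Theorems

open Real Set
open Literature.MathematicalPhysics.QuantumLattice Literature.MathematicalPhysics.QuantumLattice.BandSectorCounting
open Summit.HubbardSuperconductivity.HubbardSuperconductivity.Theorems.CountPairsOffset

set_option linter.dupNamespace false in -- summit = problem name (single-conjunct summit), D-0017
/-- **Route item `CountPairsOffset` (S5 of DECOMP = App. F Lemma F.1), PROVED**: on every level range `[a, b] ⊂ (-4, 0)`
with margin `η₀` and tolerance constant `C_δ` there is `K_p` such that for every interior `μ`, EVERY offset `P ∈ ℝ²`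
and every isotropic angular grid of `N = 2π/w` cells (`w = π/2^J ≤ 1`, `C_δ w ≤ η₀/2`),
`#{(i, j) : |ε₂(P + p(θ_i) + p(θ_j)) - μ| ≤ C_δ w} ≤ K_p (J + 2 + log N)/w` — uniformly in `P`. Proof: the uniform bounds
`bandBounds` on `[a, b]`, the small constants `exists_small_constants_offset` (with `η₀' ≤ η₀`), the two-dimensional
count `count_pairs_offset_exists` for `C_δ w ≤ η₀'/2`, and the trivial bound `N²` for the finitely many coarser grids. -/
theorem CountPairsOffset_proof :
    Summit.HubbardSuperconductivity.HubbardSuperconductivity.Theses.KLProgramme.CountPairsOffset := by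
  intro a b ha hab hb η₀ Cδ hη₀ hCδ
  obtain ⟨B, -⟩ : ∃ B : BandBounds a b, B = bandBounds ha hab hb := ⟨_, rfl⟩
  obtain ⟨τ, lam, η₀', η₁, hτ, hτπ, hlam, hη₀', hη₀'m, hη₁, hcov, hodd, heven, hH⟩ :=
    exists_small_constants_offset B hη₀
  obtain ⟨Kp, hKp, hcount⟩ := count_pairs_offset_exists B hCδ hτ hτπ hlam hη₀' hη₁ hcov hodd heven hH
  have hπ := Real.pi_pos
  obtain ⟨K₁, hK₁⟩ : ∃ K₁ : ℝ, K₁ = (4 * π * Cδ / η₀') * (2 * π) := ⟨_, rfl⟩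
  have hK₁0 : 0 < K₁ := by rw [hK₁]; positivity
  refine ⟨Kp + K₁, by positivity, ?_⟩
  intro μ hμ hlo hhi P w N Nh J hw hw1 hN hNh hNN hJ hδ
  have hN0 : (0 : ℝ) < N := by
    have : (0:ℝ) < N * w := by rw [hN]; positivity
    exact pos_of_mul_pos_left this hw.le
  have hNpos : 0 < N := Nat.pos_of_ne_zero (fun h0 => by rw [h0] at hN0; simp at hN0)
  have hN1 : (1 : ℝ) ≤ N := by exact_mod_cast hNpos
  have hlog : 0 ≤ Real.log N := Real.log_nonneg hN1
  have hJ0 : (0 : ℝ) ≤ J := by positivity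
  have hL1 : 1 ≤ (J : ℝ) + 2 + Real.log N := by linarith
  have hNw : (N : ℝ) = 2 * π / w := by field_simp; linarith only [hN]
  by_cases hsmallw : Cδ * w ≤ η₀' / 2
  · -- the main case: the two-dimensional count applies
    have hlo' : a ≤ μ - η₀' := by linarith
    have hhi' : μ + η₀' ≤ b := by linarith
    have h := hcount μ hμ hlo' hhi' P w N Nh J hw hw1 hN hNh hNN hJ hsmallw
    have hK₁' : 0 ≤ K₁ * ((J : ℝ) + 2 + Real.log N) / w := by positivity
    have e : (Kp + K₁) * ((J : ℝ) + 2 + Real.log N) / w =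
        Kp * ((J : ℝ) + 2 + Real.log N) / w + K₁ * ((J : ℝ) + 2 + Real.log N) / w := by ring
    rw [e]
    exact le_trans (le_of_eq (by rfl)) (h.trans (le_add_of_nonneg_right hK₁'))
  · -- coarse grids: the trivial bound `N² ≤ K₁/w`
    push Not at hsmallw
    have hwlow : η₀' / 2 < Cδ * w := hsmallw
    have hcard : ((((Finset.range N ×ˢ Finset.range N).filter fun p : ℕ × ℕ =>
        |eps2 (P.1 + bandX μ (w / 2 + p.1 * w) + bandX μ (w / 2 + p.2 * w))
          (P.2 + bandY μ (w / 2 + p.1 * w) + bandY μ (w / 2 + p.2 * w)) - μ| ≤ Cδ * w).card : ℝ)) ≤ (N : ℝ) * N := by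
      have h1 := Finset.card_filter_le (Finset.range N ×ˢ Finset.range N) (fun p : ℕ × ℕ =>
        |eps2 (P.1 + bandX μ (w / 2 + p.1 * w) + bandX μ (w / 2 + p.2 * w))
          (P.2 + bandY μ (w / 2 + p.1 * w) + bandY μ (w / 2 + p.2 * w)) - μ| ≤ Cδ * w)
      rw [Finset.card_product, Finset.card_range] at h1
      exact_mod_cast h1
    have hNN' : (N : ℝ) * N ≤ K₁ / w := by
      -- `N = 2π/w` and `N ≤ 2π · 2Cδ/η₀'` since `w > η₀'/(2 Cδ)`
      have hN2 : (N : ℝ) ≤ 4 * π * Cδ / η₀' := by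
        rw [hNw, div_le_div_iff₀ hw hη₀']
        nlinarith [hwlow, hπ]
      calc (N : ℝ) * N ≤ (4 * π * Cδ / η₀') * (2 * π / w) := by
            rw [← hNw]; exact mul_le_mul_of_nonneg_right hN2 hN0.le
        _ = K₁ / w := by rw [hK₁]; ring
    have hKp' : 0 ≤ Kp * ((J : ℝ) + 2 + Real.log N) / w := by positivity
    calc _ ≤ (N : ℝ) * N := hcard
      _ ≤ K₁ / w := hNN'
      _ ≤ K₁ * ((J : ℝ) + 2 + Real.log N) / w := by
          apply div_le_div_of_nonneg_right _ hw.le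
          exact le_mul_of_one_le_right hK₁0.le hL1
      _ ≤ (Kp + K₁) * ((J : ℝ) + 2 + Real.log N) / w := by
          have e : (Kp + K₁) * ((J : ℝ) + 2 + Real.log N) / w =
              Kp * ((J : ℝ) + 2 + Real.log N) / w + K₁ * ((J : ℝ) + 2 + Real.log N) / w := by ring
          rw [e]; linarith

end Summit.HubbardSuperconductivity.HubbardSuperconductivity.Theorems

end
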